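import Mathlib
import HarnessLib
import HarnessLib.Audit
import Summits.SmoothPoincare4.Statement
import Literature.Topology.FourManifolds.HomotopyBallSlice
import Literature.Topology.FourManifolds.HomotopyS4CompactProofs
import HarnessLib.Audit.Status.Attr

/-!
Route: RootDecompF

# Route RootDecompF — Root decomposition F (KnotCertificate, lens 4) — no knot certifies a fake
4-ball (homotopy-ball-slice ⟹ slice, attacked) ∧ every fake 4-ball is certified by a knot (declared
residual)

ROOT DECOMPOSITION NODE F of cell decomp-sp4 (D-0178, LADDER-SmoothPoincare4 rung 0; lens 4 =
minimal counterexample / extremal certificate; node KnotCertificate v2, adopted by the route-writer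
as OR-sibling RootDecompF). TARGET = the ROOT `_root_.SmoothPoincare4` verbatim ⟸ HBallSliceIsSlice
(E, attacked) ∧ SliceBlindStandard (R, declared residual). X = E ∧ R (root decomposition cell
decomp-sp4, lens 4 «minimal counterexample / extremal reduction», gen 0, v2; EXACT: kernel
`smoothPoincare4_iff : SmoothPoincare4 ↔ E ∧ R` in the lens file KnotCertificate.lean). The minimal
CERTIFICATE that a homotopy
4-sphere Σ is fake is one classical knot K ⊂ S³ = ∂Σ° bounding a smooth disc in Σ° and none in B⁴
(FGMW 2010; by Palais such a
pair forces Σ ≇ S⁴ — a theorem of the tree). E = `HBallSliceIsSlice`: no certificate exists (every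
knot slice in some homotopy
4-ball is slice in B⁴). R = `SliceBlindStandard`: certificates are complete (a homotopy 4-sphere all
of whose Σ°-slice knots are
slice is S⁴; contrapositively every fake 4-ball is certified by a knot). SmoothPoincare4 is NOT
proved by anything here: E and R are open, S-implied statements whose conjunction gives S by
`closes`; for tribunal scoring E is the attacked conjunct and R = SliceBlindStandard is DECLARED
RESIDUAL.
Lean: `(∀ K : Literature.Topology.FourManifolds.Knot, K.IsHomotopyBallSlice → K.IsSmoothlySlice) ∧
(open scoped ContDiff in ∀ (M : Type) [TopologicalSpace M] [T2Space M] [SecondCountableTopology M]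
[ChartedSpace (EuclideanSpace ℝ (Fin 4)) M] [IsManifold (𝓡 4) ∞ M], ContinuousMap.HomotopyEquiv M
(Metric.sphere (0 : EuclideanSpace ℝ (Fin 5)) 1) → (∀ (K : Literature.Topology.FourManifolds.Knot)
(e : EuclideanSpace ℝ (Fin 4) → M) (f : EuclideanSpace ℝ (Fin 2) → M), K.IsSliceDiscIn M e f →
K.IsSmoothlySlice) → Nonempty (M ≃ₘ⟮𝓡 4, 𝓡 4⟯ (Metric.sphere (0 : EuclideanSpace ℝ (Fin 5)) 1)))`

## Assembly
Pure logic + one landed theorem (glue.lean): given M ≃ₕ S⁴, a disc in M° makes its boundary knot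
homotopy-ball slice
(`IsSliceDiscIn.isHomotopyBallSlice`, with `CompactSpace M` from the landed
`compactSpace_of_homotopyEquiv_sphere_four_holds`),
E makes it slice, so M is slice-blind and R recognises M: `closes (hE) (hR) :
_root_.SmoothPoincare4`. Conversely S ⟹ E ∧ R
(kernel), so the AND-node is exact. DECLARED RESIDUAL (critic CLEARED 2026-08-30T01:57:06Z, W1): R =
`SliceBlindStandard` is the
recognition half without a mechanism — declared `residual: SliceBlindStandard`; the attacked
conjunct is E. (W2: the Assembly Prop item below is schema-mandatory and BC6-exempt; `closes` in
glue.lean is the deciding theorem.)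

Rationale: WHY THIS LINE. Every serious DISPROOF programme for SPC4 (FreedmanGompfMorrisonWalker2010 §1–2;
ManolescuPiccirillo2023 = arXiv:2102.04391 §1
p.3, Lemma 3.3, RBG links; Nakamura2023; the Kegel–Spreer friend census) runs through one object: a
knot slice in a homotopy
ball. The tree formalised that object (`Knot.IsHomotopyBallSlice`, `Knot.IsSliceDiscIn`) and PROVED
the certificate lemma
(`Knot.exists_exotic_of_isHomotopyBallSlice_not_isSmoothlySlice_holds`), but only NEGATIVE routes
use it (ZeroSurgeryExotic,
VerlindeRLinks, DottedCircleRasmussen). This line is the positive completion: S ⟺ (no certificate) ∧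
(certificates complete).
E is a pure knot-concordance statement — attackable by sliceness TRANSFER and by showing concordance
invariants blind on homotopy
balls (τ, ε, ν⁺, Υ, s♯ already are: MP 2021 p.3; s on Gluck-twist balls:
ManolescuMarengonSarkarWillis2023 Cor 1.13 = tree
`rasmussen_eq_zero_of_isSliceDiscIn_gluckTwist`; the s-question is MMSW Q 9.11), and instrumentable
by the census's friend sweeps
(M6) and the ribbon hunt for Manolescu's named candidate 18nh_00000601 in its explicit ball W (M7).
R imports the detection
philosophy of relative exotica — Akbulut 1991 (doi:10.4310/jdg/1214446320: cork smoothings rel ∂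
distinguished by a slice knot),
Hayden–Mark–Piccirillo arXiv:1908.05269, Manolescu–Marengon–Piccirillo arXiv:2012.12270 (H-slice
knots detect exotic structures) —
and asks it of homotopy balls. Imported area: knot concordance / Khovanov–Floer sliceness
obstructions; no handle hypothesis, no
connected sum, no stabilisation (differs by construction from NoOneHandles, SchoenfliesSplit,
Stabilisation, DissolvableGluck and
from this cell's mirror and ℂℙ² nodes). Workshop record (writer decomp-sp4-writer-1-g0, cell
decomp-sp4, rung 0, D-0178): this is root node KnotCertificate of lens 4 (NODE 2026-08-30T01:55:55Z
on HOME/STATUS.md line 40; lens kernel file decomp-sp4-lens-4/KnotCertificate.lean sha256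
7db888ab975643c4631251d906982e8e016c8aaa2ef17c277b258422c06ba382 — closes, smoothPoincare4_iff :
SmoothPoincare4 ↔ E ∧ R, NECESSITY of both pieces (S ⟹ E = the FGMW certificate lemma over the
tree-PROVED `Knot.exists_exotic_of_isHomotopyBallSlice_not_isSmoothlySlice_holds`; S ⟹ R shielded),
`hBallSliceIsSlice_iff_not_zseHsliceNotSlice` (E = ¬ item #0520 of route ZeroSurgeryExotic
verbatim), `not_spc4_of_not_hBallSliceIsSlice`, `isSliceBlind_of_nonempty_diffeomorph` (Palais: R's
hypothesis holds on S⁴); NODE.md sha256 41b02e25b73b5965…; lens Route.md sha256 3a07ade3…, lens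
native_check.txt OK, lens tribunal_kernel.json), adopted unchanged (items E, R, Assembly; residual
already declared by the lens after critic W1) as OR-sibling RootDecompF (critic scoring: a NEW AXIS
— knot certificates — distinct from the handle / mirror / ℂℙ² / trisection nodes A–E; the lens's v1
MirrorInverse node was withdrawn 01:43:14Z as the mirror axis of nodes A/C). Critic verdict: CLEARED
decomp-sp4-crit-1-g0 2026-08-30T01:57:06Z (HOME/STATUS.md line 41 «CLEARED … NODE lens-4
KnotCertificate (S ⟺ HBallSliceIsSlice[E] ∧ SliceBlindStandard[R]; file
decomp-sp4-lens-4/KnotCertificate.lean sha256 7db888ab…) — … rc0, 0 sorry, 0 warnings, axioms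
{propext, Classical.choice, Quot.sound}; closes (hE) (hR) : _root_.SmoothPoincare4 exact AND into
the typed ROOT ✓; NECESSARY kernel-proved ✓; no EQUIV layer ✓»; typing read against
Literature/Topology/FourManifolds/HomotopyBallSlice.lean: E over `Knot` = C^∞ SphereEmbedding 1 3
and `IsHomotopyBallSlice`, the vetted predicates the landed FGMW theorem is proved over;
`IsSliceDiscIn M e f` a proper disc in M°; in critic/Standing terms the node is Existence(P) ∧
Recognition(P) with P = slice-blind and HoldsOnStandard P PROVED, so the split itself is free and
all value sits in P; R's hypothesis idle iff E is a theorem, E printed-open (FGMW §1, MP 2021 p.3,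
MMSW Q9.11) ⇒ not idle; junk ∅ / S⁴ ⊔ S⁴ / ℝℙ⁴ excluded by ≃ₕ ✓), lens W1–W3 answered
2026-08-30T01:59:10Z (R re-tagged DECLARED-RESIDUAL in the package; W2 Assembly item kept as
schema-mandatory; W3 layer-2 road via #16179 marked not filed); CRITIC-LEDGER.md row lens-4. Tags:
HBallSliceIsSlice E = WEAKER (evidence: (i) dual-P3 instances decided S-independently inside
UNDECIDED spheres — MP 2021 Ex. 6.4 (K = 8₈ / K′ both ribbon, X not verified S⁴ [corpus
arxiv-2102.04391 p.17]) and the census Φ5 rows closed «both ribbon»; (ii) partial theorems toward E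
not via Σ ≅ S⁴: concordance-invariant blindness on H-slice knots τ/ε/ν⁺/Υ/s♯ (B27) and s = 0 on
Gluck-twist balls (MMSW Cor 1.13 = tree `rasmussen_eq_zero_of_isSliceDiscIn_gluckTwist`, A7); (iii)
printed open; and LOAD-BEARING in the strongest sense: ¬E alone is ¬S) · ATTACKABLE (s-blindness
Q9.11 / lasagna; sliceness transfer on Gluck-twist & RBG balls) · INSTRUMENTABLE (M7 ribbon hunt for
18nh_00000601 in its explicit ball W ≈45 core-h = a named undecided E-instance; then M6 friend sweep
≈50 core-h); SliceBlindStandard R = lens tag «WEAKER (by scope)» NOT accepted as evidence-grade —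
RE-TAGGED UNDECIDED → DECLARED-RESIDUAL (P3 structurally unavailable on both sides; the claimed
domination R|GSC ⟸ VrlSliceRigidity #16179 is on paper only and #16179 is HELD modulo
Andrews–Curtis, B30) · IDEA-NEEDED (no mechanism turning «Σ exotic» into a certifying knot). Census
instrument cited: HOME/census/COSTUME-CENSUS-v1.md sha256
2113a3b3fb46bf7e878c545d4df5cf6f6d17f195411b0a604bea94d1c5e2365a (json sha256
4ecf75d8f1243bec80a6cd253a099e5495e481c469a741cd69a87d0230d84e02; census tests named: M7 then M6).
BC5 witness of weakness (by name, the module is cited not imported): instances of E decided without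
deciding their sphere — Manolescu–Piccirillo 2021 Ex. 6.4 (arXiv:2102.04391 p.17) and the tree
theorem `Literature.…rasmussen_eq_zero_of_isSliceDiscIn_gluckTwist` (s cannot certify a Gluck-twist
ball) — regimes where S is not known. Why this is novel (one sentence): it is the first POSITIVE use
of the tree's formalised FGMW certificate object — every homotopy-ball-slice knot is slice — as a
root conjunct of S, turning the live disproof programme's search space into the attacked half of an
exact decomposition whose other half (certificate completeness) is named and declared residual.

RANKED CRUXES. #2 HBallSliceIsSlice (crux) — E (piece 1, «no knot certifies a fake 4-ball»; the
ATTACKED conjunct; WEAKER; leaves ATTACKABLE + INSTRUMENTABLE): every knot K ⊂ S³ that bounds a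
smooth properly embedded disc in the punctured ball Σ° of SOME closed smooth homotopy 4-sphere Σ
(tree `Knot.IsHomotopyBallSlice`) is smoothly slice in B⁴ (tree `Knot.IsSmoothlySlice`). S ⟹ E
kernel (`hBallSliceIsSlice_of_spc4`, the FGMW lemma); E is verbatim ¬(waypoint ZseHsliceNotSlice
#0520 of route ZeroSurgeryExotic) (kernel `hBallSliceIsSlice_iff_not_zseHsliceNotSlice`); E ⟹ S
unknown (needs R); population form: E ⟺ every homotopy 4-sphere is slice-blind (kernel
`hBallSliceIsSlice_iff_forall_isSliceBlind`). Critic verdict: WEAKER (S-independent decided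
instances MP 2021 Ex. 6.4, census Φ5 «both ribbon» rows; invariant-blindness partial theorems;
printed open FGMW §1 / MP 2021 / MMSW Q9.11; ¬E alone is ¬S) · ATTACKABLE · INSTRUMENTABLE (M7 ≈45
core-h, then M6) — CLEARED decomp-sp4-crit-1-g0 2026-08-30T01:57:06Z; attacked (node score).
[difficulty: open-problem] (why it might fail: a 0-surgery pair (K slice, K′ not) makes K′
homotopy-ball-slice and non-slice — #0520/#0364 live; e.g. pub-sp4mp row 376 (L14a28873[1,1]: K_G
has s ≠ 0, K_B 83-cr undecided — K_B slice would refute E and S); s ≠ 0 on some HBS knot (MMSW Q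
9.11).) [FreedmanGompfMorrisonWalker2010, arXiv:2102.04391, ManolescuMarengonSarkarWillis2023,
Nakamura2023, DunfieldGong2025]
#3 SliceBlindStandard (crux) — R (piece 2, «every fake 4-ball is certified by a knot»;
DECLARED-RESIDUAL — critic ruling 01:57:06Z: recognition half without mechanism, no P3 specimen
possible on either side; lens information «S ⟹ R, R = exact open converse of the proved standard ⟹
slice-blind» kept as placement only; leaf IDEA-NEEDED): for every smooth 4-manifold M (Hausdorff,
second countable, C^∞ on 𝓡 4) homotopy equivalent to S⁴: if every knot bounding a smooth proper disc
in M ∖ e(B̊⁴) for some smoothly embedded 4-ball e (an `IsSliceDiscIn` datum) is slice in B⁴, then M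
≅ S⁴. Kernel forms: S ⟹ R shielded (`sliceBlindStandard_of_spc4`); R ⟺ every homotopy 4-sphere with
IsEmpty (M ≃ₘ S⁴) is knot-detected (`sliceBlindStandard_iff_knotDetected`). On 1-handle-free spheres
Σ_L, R is dominated by the registered crux VrlSliceRigidity #16179 via the PROVED
VrlComponentsHBallSlice #15874 (paper argument: attaching-link components bound the 2-handle cores
in Σ_L°). Critic verdict: UNDECIDED ⇒ DECLARED-RESIDUAL (recognition half without mechanism; P3
structurally unavailable; paper domination via HELD #16179 earns no credit) · IDEA-NEEDED — CLEARED
decomp-sp4-crit-1-g0 2026-08-30T01:57:06Z; no seat asked. [difficulty: open-problem] (why it might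
fail: a fake 4-ball invisible to knot concordance — every concordance invariant to date is provably
blind on homotopy balls (τ, ε, ν⁺, Υ, s♯; s on Gluck twists, BARRIERS B27/A7), and knotted
slice-disc systems show sliceness of an attaching link does not rebuild Σ_L.)
[FreedmanGompfMorrisonWalker2010, doi:10.4310/jdg/1214446320, arXiv:1908.05269, arXiv:2012.12270,
GompfScharlemannThompson2010]

TWO-LAYER PLAN. HBallSliceIsSlice ⇐ [s vanishes on homotopy-ball-slice knots (MMSW Q 9.11; the
tree's `MMSW2023Question911Knot` negated)] is NOT
a split (s = 0 does not give a disc); foreseen glued split by BALL FAMILY instead: E ⇐ E|Gluck-twist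
balls ∧ E|RBG/annulus-twist balls
∧ [every homotopy ball is one of these] — the third conjunct has no evidence, so not filed; the
honest layer 2 is by INVARIANT
COMPLETENESS on the refutation side (each blind-invariant theorem shrinks the space of possible
certificates). SliceBlindStandard ⇐
[R for 1-handle-free spheres, via VrlSliceRigidity #16179 + #15874] ∧ [A1 NoohNoOneHandles #0378] —
foreseen, not filed (the first
conjunct inherits #16179's Andrews–Curtis debt, BARRIERS B30).

KILL CRITERIA. E is refuted by any landed proof of ZseHsliceNotSlice #0520 / ZseThesis #0364 (a knot
slice in a homotopy ball, not in B⁴) →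
close `refuted:HBallSliceIsSlice`; that certificate is ¬S outright (tree theorem), so the summit
dies with the piece. R is
refuted by an exotic homotopy sphere proved slice-blind — not a realistic event (it presupposes ¬S
plus a blindness theorem for
ALL knots); R is retired instead if a blindness meta-theorem lands («every knot slice in any
homotopy ball is slice» = E proved
makes R ≡ S, critic/Standing `recognition_iff_spc4_of_existence`) — then the route collapses to S
and is closed `not-a-thesis`.
Superseded if a positive route adopts E as a crux with a stronger recognition partner.

NOT DECOMPOSED YET. The ball-family split of E (needs typed Gluck-twist / RBG ball predicates on
`IsSliceDiscIn` data: `IsGluckTwist` exists,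
RBG balls do not); the s-sub-question as a support item (needs `HasRasmussenInvariant`, currently
blocking #0366/#0368); the
1-handle-free case of R via #16179 (FramedLink plumbing: cores of 2-handles as `IsSliceDiscIn` data
is exactly the proved #15874).

CHEAPEST FALSIFIER. Lookup: is «slice in a homotopy 4-ball ⟹ slice in B⁴» known (either way)?
Corpus: MP 2021 p.3 [corpus:arxiv-2102.04391 p0003]
states the FGMW strategy as live and «it is unknown whether s necessarily vanishes when K bounds a
smooth disk in a homotopy
ball»; §6.3 p.17 [p0017] exhibits homotopy spheres with both K, K′ slice «for which we could not
verify that X is S⁴»; census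
COSTUME-CENSUS-v1 N1/N2/Φ5 + pub-sp4mp CANDIDATES.jsonl: 388 rows, 0 certificates, 10 open rows
(listed under Numbers). Galaxy: «H-slice|homotopy ball slice|slice in a homotopy»
--star all (run for this node, see NODE.md). In-Lean: BC2/BC4 probes (bc/): E → S, R → S, ⊢ E, ⊢ R,
⊢ ¬E, ⊢ ¬R, E → R, R → E all
FAIL; crux probe 2/2 CLEAN. The cheapest kill of the LINE is a proof that E is a theorem of
TOP-flavoured generality (making R ≡ S)
— no such argument exists in the smooth category (it would prove SPC4 ⟹ nothing; rather it IS half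
of SPC4).

NUMBERS. Census pub-sp4mp CANDIDATES.jsonl (388 Manolescu–Piccirillo / Dunfield–Gong / Kegel–Spreer
trace-swap rows; COSTUME-CENSUS-v1 Φ5, N1, N2),
read for this node as E-INSTANCES (W3). In a row with K slice and K′ its 0-friend, K′ bounds the
core disc in the homotopy sphere X, so
K′ is homotopy-ball-slice and E predicts «K′ slice». (a) DECIDED S-INDEPENDENTLY (both knots ribbon
by explicit band certificates,
sphere X NOT decided — dual-P3 evidence for E): rows 369, 370, 371 (L14a26993[R=2, r=−1,−2,−3]), 372
(L14a27005[2,1]), 373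
(L14a27049[2,3]), 374 (L14a27053[2,2]) — 6 rows, verdict X-SLICE-BOTH; plus MP 2021 Ex. 6.4 (8₈ and
its annulus twists).
(b) DECIDED VIA THE SPHERE (not S-independent): row 25, K = 18nh_00000601 — Oliveira–Smith
arXiv:2603.23717 Thm 1.1 (X_DG ≅ S⁴) ⇒
Cor 1.2 (K slice in B⁴); census test M7 (explicit ribbon band for 18nh_00000601, 45 core-h) would
re-certify this instance
S-independently. (c) OPEN E-instances-to-decide (each resolves to a banked E-instance or a ¬E = ¬S
certificate): rows 383, 384
(L14n57384[1,1], [1,3]: K_G ribbon, K_B 52/45 cr undecided — E predicts K_B slice), 386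
(L14n57388[1,−3]: K_G ribbon, K_B 68 cr —
E predicts slice), 376 (L14a28873[1,1]: K_G s ≠ 0 not slice, K_B 83 cr undecided — E predicts K_B
NOT slice; K_B slice ⇒ certificate),
378 (L14a28874[1,1]), 379 (L14a28877[1,−3]), 385 (L14n57385[1,1]), 387 (K_3[T+]), 388 (K_5[T+])
(U-ENGINE: s-cells incomplete, both
knots undecided), 12 (18nh_00010270, U-S) — 10 rows; instruments M6 (friend sweep, 50 core-h) /
ribbon searches on the K_B of 383,
384, 386 first (smallest diagrams 45–68 cr). MP's five RBG candidates: knots not slice (Nakamura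
2023 Thm 1.1) ⇒ no sphere built.

DEFINITION REQUESTS. None for the filed items (all notions in the tree: `Knot`,
`Knot.IsHomotopyBallSlice`, `Knot.IsSliceDiscIn`,
`Knot.IsSmoothlySlice`). Wanted later: `HasRasmussenInvariant` (blocks the s-sub-question, already
requested by ZeroSurgeryExotic

Novelty: Searches (2026-08-30): `ledger negatives --problem SmoothPoincare4` (0 refuted statements); rg over
the 68 Theses for `IsHomotopyBallSlice|IsSliceDiscIn|IsSmoothlySlice →` (hits: ZeroSurgeryExotic
#0520 `∃ K, HBS ∧ ¬slice` and #0364 (negative), VerlindeRLinks #15874/#16179 (negative route; #16179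
positive-shaped rigidity for R-links), DottedCircleRasmussen/DcrGap (negative),
SoloInformedPunctured* theorems; NO positive route with `∀ K, IsHomotopyBallSlice K →
IsSmoothlySlice K` or a slice-blind recognition statement); HOME bus NODE lines of lenses 2, 3, 6
(mirror ×2, ℂℙ²-carving) and my withdrawn MirrorInverse; lit read arxiv:2102.04391 --grep
'H-slice|homotopy ball' (51 hits; p.3, p.5, p.17 read); lit search "fake compact contractible
4-manifold slice Akbulut" (Akbulut 1991 doi:10.4310/jdg/1214446320 via zbMATH; HMP arXiv:1908.05269;
MMP arXiv:2012.12270 held); lit galaxy search "H-slice|slice in a homotopy|homotopy 4-ball" --star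
all (see NODE.md for hit count); census COSTUME-CENSUS-v1 rows N1, N2, N6, Φ5, T64, T68, F7.
Nearest prior art found: FreedmanGompfMorrisonWalker2010 §1–2 (the certificate lemma; strategy);
arXiv:2102.04391 (MP: systematic certificate supply, §6.3 undecided both-slice spheres);
ManolescuMarengonSarkarWillis2023 Q 9.11 (s on homotopy-ball-slice knots); arXiv:2012.12270 (H-slice
knots detect exotica, b₂ > 0); doi:10.4310/jdg/1214446320 (Akbulut: slice knot detects cork
smoothings); tree routes ZeroSurgeryExotic (#0520 = ¬E) and VerlindeRLinks (#16179  [refs: 10.4310/jdg/1214446320, 2102.04391, 1908.05269, 2012.12270, arxiv:2102.04391, doi:10.4310/jdg/1214446320, FreedmanGompfMorrisonWalker2010, ManolescuMarengonSarkarWillis2023]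

Barriers (technique_class: knot-concordance, slice-obstructions, trace-embedding): - technique_class: knot-concordance, slice-obstructions, trace-embedding
- BARRIERS.lean §A1 (TopologicalInvariantsBlind.lean / TopologicalBarrierFour; outside the gate
catalogue, cited as prose): E and R are smooth-category statements whose TOP shadows are theorems (a
TOP homotopy ball is B⁴ by Freedman, so «TOP-ball-slice ⟹ TOP-slice» holds) — the line never
evaluates a homeomorphism invariant; the certificate K is read by SMOOTH concordance invariants
only, which is exactly what A1 leaves open.
- Literature.Barriers.SmoothPoincare4.GluckTwistCP2Barrier: bites the s-INSTRUMENT on Gluck-twist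
balls (tree `rasmussen_eq_zero_of_isSliceDiscIn_gluckTwist`: s cannot certify a Gluck-twist ball) —
for E this is SUPPORT (one more blind invariant), for R it is an honest restriction: on Φ2 the
certifying knot, if any, must be caught by a non-ℂℙ²-stable obstruction; the bet is on sliceness
itself (ribbon search / trace embeddings), not on s.
- Literature.Barriers.SmoothPoincare4.GaugeSumBarrierFour and
Literature.Barriers.SmoothPoincare4.HCobordismInvariantBarrierFour: OUTSIDE — no gauge or
h-cobordism invariant of Σ is evaluated; the invariants in play are knot-concordance invariants of K
⊂ S³, and their known blindness on homotopy-ball-slice knots (B27) is evidence FOR E, not an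
obstruction to the line.
- Literature.Barriers.SmoothPoincare4.ContractibleBarrierFour (with
RelativeContractibleBarrierFour): R's analogue evidence (Akbulut 1991, HMP 2019) lives on
contractible pieces with

sub-problem: SmoothPoincare4 · status: open · opened planner-decomp-sp4-writer-1-g0-0 2026-08-30T02:32:25Z · rev 0 · ledger route-SmoothPoincare4-RootDecompF
GENERATED by the gate from the ledger (D-0016/17). Provers cite these decls: `theorem foo : Summit.SmoothPoincare4.SmoothPoincare4.Theses.RootDecompF.<Decl> := …` in Summits/SmoothPoincare4/SmoothPoincare4/Theorems/<Name>.lean.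
-/

namespace Summit.SmoothPoincare4.SmoothPoincare4.Theses.RootDecompF

open scoped BigOperators Topology Manifold Classical MeasureTheory ProbabilityTheory Matrix InnerProductSpace ComplexConjugate ContinuousMap
open Filter Set Function TopologicalSpace MeasureTheory

attribute [summit_statement] _root_.SmoothPoincare4

open Literature.SPC4

/-- item stmt-SmoothPoincare4-25344 · crux · rank 2 · open · by planner
why it might fail: a 0-surgery pair (K slice, K′ not) makes K′ homotopy-ball-slice and non-slice — #0520/#0364 live; e.g. pub-sp4mp row 376 (L14a28873[1,1]: K_G has s ≠ 0, K_B 83-cr undecided — K_B slice would refute E and S); s ≠ 0 on some HBS knot (MMSW Q 9.11).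
sources: FreedmanGompfMorrisonWalker2010, arXiv:2102.04391, ManolescuMarengonSarkarWillis2023, Nakamura2023, DunfieldGong2025
[crux] E (piece 1, «no knot certifies a fake 4-ball»; the ATTACKED conjunct; WEAKER; leaves
ATTACKABLE + INSTRUMENTABLE): every knot K ⊂ S³ that bounds a smooth properly embedded disc in the
punctured ball Σ° of SOME closed smooth homotopy 4-sphere Σ (tree `Knot.IsHomotopyBallSlice`) is
smoothly slice in B⁴ (tree `Knot.IsSmoothlySlice`). S ⟹ E kernel (`hBallSliceIsSlice_of_spc4`, the
FGMW lemma); E is verbatim ¬(waypoint ZseHsliceNotSlice #0520 of route ZeroSurgeryExotic) (kernel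
`hBallSliceIsSlice_iff_not_zseHsliceNotSlice`); E ⟹ S unknown (needs R); population form: E ⟺ every
homotopy 4-sphere is slice-blind (kernel `hBallSliceIsSlice_iff_forall_isSliceBlind`). Critic
verdict: WEAKER (S-independent decided instances MP 2021 Ex. 6.4, census Φ5 «both ribbon» rows;
invariant-blindness partial theorems; printed open FGMW §1 / MP 2021 / MMSW Q9.11; ¬E alone is ¬S) ·
ATTACKABLE · INSTRUMENTABLE (M7 ≈45 core-h, then M6) — CLEARED decomp-sp4-crit-1-g0
2026-08-30T01:57:06Z; attacked (node score). [difficulty: open-problem] -/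
@[route_item "route-SmoothPoincare4-RootDecompF", crux]
def HBallSliceIsSlice : Prop :=
  ∀ K : Literature.Topology.FourManifolds.Knot, K.IsHomotopyBallSlice → K.IsSmoothlySlice

/-- item stmt-SmoothPoincare4-25345 · crux · rank 3 · open · by planner
why it might fail: a fake 4-ball invisible to knot concordance — every concordance invariant to date is provably blind on homotopy balls (τ, ε, ν⁺, Υ, s♯; s on Gluck twists, BARRIERS B27/A7), and knotted slice-disc systems show sliceness of an attaching link does not rebuild Σ_L.
sources: FreedmanGompfMorrisonWalker2010, doi:10.4310/jdg/1214446320, arXiv:1908.05269, arXiv:2012.12270, GompfScharlemannThompson2010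
[crux] R (piece 2, «every fake 4-ball is certified by a knot»; DECLARED-RESIDUAL — critic ruling
01:57:06Z: recognition half without mechanism, no P3 specimen possible on either side; lens
information «S ⟹ R, R = exact open converse of the proved standard ⟹ slice-blind» kept as placement
only; leaf IDEA-NEEDED): for every smooth 4-manifold M (Hausdorff, second countable, C^∞ on 𝓡 4)
homotopy equivalent to S⁴: if every knot bounding a smooth proper disc in M ∖ e(B̊⁴) for some
smoothly embedded 4-ball e (an `IsSliceDiscIn` datum) is slice in B⁴, then M ≅ S⁴. Kernel forms: S ⟹
R shielded (`sliceBlindStandard_of_spc4`); R ⟺ every homotopy 4-sphere with IsEmpty (M ≃ₘ S⁴) is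
knot-detected (`sliceBlindStandard_iff_knotDetected`). On 1-handle-free spheres Σ_L, R is dominated
by the registered crux VrlSliceRigidity #16179 via the PROVED VrlComponentsHBallSlice #15874 (paper
argument: attaching-link components bound the 2-handle cores in Σ_L°). Critic verdict: UNDECIDED ⇒
DECLARED-RESIDUAL (recognition half without mechanism; P3 structurally unavailable; paper domination
via HELD #16179 earns no credit) · IDEA-NEEDED — CLEARED decomp-sp4-crit-1-g0 2026-08-30T01:57:06Z;
no seat asked. [diffic -/
@[route_item "route-SmoothPoincare4-RootDecompF", crux]
def SliceBlindStandard : Prop :=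
  open scoped ContDiff in ∀ (M : Type) [TopologicalSpace M] [T2Space M] [SecondCountableTopology M] [ChartedSpace (EuclideanSpace ℝ (Fin 4)) M] [IsManifold (𝓡 4) ∞ M], ContinuousMap.HomotopyEquiv M (Metric.sphere (0 : EuclideanSpace ℝ (Fin 5)) 1) → (∀ (K : Literature.Topology.FourManifolds.Knot) (e : EuclideanSpace ℝ (Fin 4) → M) (f : EuclideanSpace ℝ (Fin 2) → M), K.IsSliceDiscIn M e f → K.IsSmoothlySlice) → Nonempty (M ≃ₘ⟮𝓡 4, 𝓡 4⟯ (Metric.sphere (0 : EuclideanSpace ℝ (Fin 5)) 1))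

/-- item stmt-SmoothPoincare4-25346 · assembly · rank 1 · open · by planner
sources: FreedmanGompfMorrisonWalker2010
[assembly] HBallSliceIsSlice → SliceBlindStandard → SmoothPoincare4 (pointwise: slice-blindness from
E, recognition from R). Kept because route.schema requires exactly one assembly item at open
(`route.schema/assembly-count`); the gate's BC6 exempts it (precedent RootDecompA: «exempt
Assembly»); `closes` in glue.lean is the deciding theorem. -/
@[route_item "route-SmoothPoincare4-RootDecompF"]
def Assembly : Prop :=
  HBallSliceIsSlice → SliceBlindStandard → _root_.SmoothPoincare4

/-! D-0027 §2.1 — DECIDING THEOREM (planner-authored via `route open/edit --closes-file`; by planner-decomp-sp4-writer-1-g0-0 2026-08-30T02:32:25Z):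
its hypotheses are this route's items and its conclusion the sub-problem Statement (glue_lint), and it elaborates with this file. -/

@[closes "route-SmoothPoincare4-RootDecompF"] theorem closes (hE : HBallSliceIsSlice) (hR : SliceBlindStandard) : _root_.SmoothPoincare4 := by
  intro M _ _ _ _ _ e
  refine hR M e ?_
  intro K c f hd
  haveI := Literature.Topology.FourManifolds.compactSpace_of_homotopyEquiv_sphere_four_holds M e
  exact hE K (hd.isHomotopyBallSlice ⟨e⟩)

end Summit.SmoothPoincare4.SmoothPoincare4.Theses.RootDecompF
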